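import Summits.ResolutionOfSingularities.ResolutionOfSingularities.Theorems.LossShearX2
import Mathlib.Data.Nat.Choose.Lucas
import HarnessLib

/-!
# LossShearX2Line — the law (L_X2), PART B: support domination PROVED line by line; `lawX2 : LawX2` hyp-free

decomp-res-lens-3, gen 28 (NODE-g28 rev 2 §6.7; sequel of `Theorems.LossShearX2`, split at the gate's 400-line lint — the two files
were checked as one).  First half of the PAIR `lawX2 : LawX2` + `lawLossEntry : LawLossEntry` of critic letter row 220l (the +1 is the
pair; this file alone is 0 by that letter and is banked by name).

For ANY equation `F`: put `g = 1/ν`, `G = σ_{j→l}^ν F` (X2 reading), `H = σ_{l→j}^g F` (X1 reading).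
KEY IDENTITY (`swapShear_shear`): `H = G ∘ (u_j ↦ −ν u_l, u_l ↦ u_l + g u_j)` — both charts see the same closed point
`(u_j : u_l) = (ν : 1) = (1 : g)` — so on every line `L = (E_i = A, E_j + E_l = n)` the coefficients of `H` are a TRIANGULAR
combination of those of `G`: `coeff_{(A, n−T, T)} H = g^{n−T} Σ_{r ≤ T} binom(n−r, T−r) (−ν)^r coeff_{(A, r, n−r)} G` (`coeff_swapShear`).
Take `T` = the least `r` with `u^{(A,r,n−r)}` a NON-`q`-th-power monomial of `G` (`Nat.find`): the term `r = T` is a unit times a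
non-zero coefficient, a term `r < T` with a non-`q`-th-power exponent is absent by minimality, and a term `r < T` with a `q`-th-power
exponent (`q | A`, `q | r`, `q | n − r`) carries `binom(n−r, T−r) ≡ 0 (mod p)` by LUCAS, because `q ∤ T − r` (else `(A, T, n−T)` would be
a `q`-th power).  Hence `(A, n−T, T)` is a non-`q`-th-power monomial of `H` with `l`-exponent `T ≤ E_j` (`exists_dom_swapShear`); the
converse direction is the same lemma with `(j, l, ν, g) ↔ (l, j, g, ν)`.  No root multiplicities are needed (simpler than NODE §6.6 F15).
* §4 Lucas: `binom(D, T) ≡ 0 (mod p)` when `p^a | D`, `p^a ∤ T` (`choose_modEq_zero_of_pow_dvd`, from Mathlib's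
  `Choose.choose_modEq_choose_mod_mul_choose_div_nat`); `cast_choose_eq_zero_of_pow_dvd`.
* §5 the substitution `swapShear j l ν g`, `swapShear_shear`, its monomial expansion `swapShear_monomial` and `coeff_swapShear`.
* §6 `isPthPowerExponent_iff_of_fin3`, `exists_dom_swapShear` (the line argument), `shearDom_of_mul_eq_one : ν g = 1 → ShearDom …`.
* §7 `lawShearDomAt_of_lucas`, `lawShearDom : LawShearDom`, **`lawX2 : LawX2`**, and the located residual from the ONE remaining law:
  `noLossyStrictTailsDeep_of_lawLossEntry : LawLossEntry → NoLossyStrictTailsDeep` (27367 ⟸ `LawLossEntry` alone).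
[CJS2020] = Cossart–Jannsen–Saito arXiv:0905.2191, Lemma 13.3 / Lemma 232.
-/

open MvPolynomial Finset
open Literature.AlgebraicGeometry.Resolution
open Literature.AlgebraicGeometry.Resolution.Hauser2010
open Literature.AlgebraicGeometry.Resolution.PointBlowup
open Summit.ResolutionOfSingularities.ResolutionOfSingularities.Theorems.TightDefectClasses
open Summit.ResolutionOfSingularities.ResolutionOfSingularities.Theorems.TightDefectStrongWalks
open Summit.ResolutionOfSingularities.ResolutionOfSingularities.Theorems.ItineraryCutClasses
open Summit.ResolutionOfSingularities.ResolutionOfSingularities.Theorems.BoundaryLedger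
open Summit.ResolutionOfSingularities.ResolutionOfSingularities.Theorems.ProximityCut
open Summit.ResolutionOfSingularities.ResolutionOfSingularities.Theorems.WallCut
open Summit.ResolutionOfSingularities.ResolutionOfSingularities.Theorems.LossExitCone

namespace Summit.ResolutionOfSingularities.ResolutionOfSingularities.Theorems.LossPolygon

/-! ## §4 Lucas: binomial coefficients vanishing in characteristic `p` -/

section Lucas

/-- **Lucas (PROVED from Mathlib's `Choose.choose_modEq_choose_mod_mul_choose_div_nat`):** if `p^a ∣ D` and `p^a ∤ T` then
`p ∣ binom(D, T)` — some base-`p` digit of `T` below position `a` is non-zero while that digit of `D` vanishes. [folklore] -/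
theorem choose_modEq_zero_of_pow_dvd (p : ℕ) [hp : Fact p.Prime] :
    ∀ (a D T : ℕ), p ^ a ∣ D → ¬ p ^ a ∣ T → D.choose T ≡ 0 [MOD p]
  | 0, _, T, _, hT => absurd (by rw [pow_zero]; exact one_dvd T) hT
  | a + 1, D, T, hD, hT => by
      have hp0 : 0 < p := hp.out.pos
      have h := Choose.choose_modEq_choose_mod_mul_choose_div_nat (n := D) (k := T) (p := p)
      have hpD : p ∣ D := dvd_trans (dvd_pow_self p (Nat.succ_ne_zero a)) hD
      rw [Nat.mod_eq_zero_of_dvd hpD] at h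
      by_cases hT0 : T % p = 0
      · rw [hT0, Nat.choose_zero_right, one_mul] at h
        have hD' : p ^ a ∣ D / p := by
          obtain ⟨c, hc⟩ := hD
          rw [hc, pow_succ, mul_assoc, mul_comm p c, ← mul_assoc, Nat.mul_div_cancel _ hp0]
          exact dvd_mul_right _ _
        have hT' : ¬ p ^ a ∣ T / p := fun h' => hT (by
          rw [← Nat.div_add_mod T p, hT0, add_zero, pow_succ, mul_comm (p ^ a) p]
          exact mul_dvd_mul_left p h')
        exact h.trans (choose_modEq_zero_of_pow_dvd p a (D / p) (T / p) hD' hT')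
      · rw [Nat.choose_eq_zero_of_lt (Nat.pos_of_ne_zero hT0), zero_mul] at h
        exact h

/-- **Lucas in the residue field (PROVED):** `binom(D, T) = 0` in a field of characteristic `p` when `p^a ∣ D`, `p^a ∤ T`. [folklore] -/
theorem cast_choose_eq_zero_of_pow_dvd {K : Type} [Field K] (p : ℕ) [Fact p.Prime] [CharP K p] {a D T : ℕ}
    (hD : p ^ a ∣ D) (hT : ¬ p ^ a ∣ T) : ((D.choose T : ℕ) : K) = 0 :=
  (CharP.cast_eq_zero_iff K p _).mpr (Nat.modEq_zero_iff_dvd.mp (choose_modEq_zero_of_pow_dvd p a D T hD hT))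

end Lucas

variable {K : Type} [Field K] [DecidableEq K] {q : ℕ}
variable {i j l : Fin 3}

/-! ## §5 The substitution `u_j ↦ −ν u_l, u_l ↦ u_l + g u_j` carrying the X2 reading to the X1 reading -/

/-- The linear substitution `u_j ↦ −ν·u_l`, `u_l ↦ u_l + g·u_j` (third letter fixed): for `ν g = 1` it carries the X2-prepared equation
`σ_{j→l}^ν F` to the X1-prepared equation `σ_{l→j}^g F` (`swapShear_shear`). [new; elementary] -/
noncomputable def swapShear (j l : Fin 3) (ν g : K) : MvPolynomial (Fin 3) K →ₐ[K] MvPolynomial (Fin 3) K :=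
  aeval fun w => if w = j then C (-ν) * X l else if w = l then X l + C g * X j else X w

omit [DecidableEq K] in
/-- Unfolding rule of `swapShear` on a variable. [new; elementary] -/
theorem swapShear_X (j l : Fin 3) (ν g : K) (w : Fin 3) :
    swapShear j l ν g (X w) = if w = j then C (-ν) * X l else if w = l then X l + C g * X j else X w := by
  unfold swapShear; rw [aeval_X]

omit [DecidableEq K] in
/-- **KEY IDENTITY (PROVED): the X1 reading is the X2 reading after the substitution**, `σ_{l→j}^g F = swapShear (σ_{j→l}^ν F)` for
`ν g = 1` — both charts see the same closed point `(u_j : u_l) = (ν : 1) = (1 : g)` of the exceptional line. [new; elementary] -/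
theorem swapShear_shear (hjl : j ≠ l) {ν g : K} (hνg : ν * g = 1) (F : MvPolynomial (Fin 3) K) :
    swapShear j l ν g (shear j l ν F) = shear l j g F := by
  have h1 : (C (-ν) : MvPolynomial (Fin 3) K) = -C ν := map_neg C ν
  have h2 : (C ν : MvPolynomial (Fin 3) K) * C g = 1 := by rw [← map_mul, hνg, map_one]
  have key : (swapShear j l ν g).comp (shear j l ν) = shear (K := K) l j g := by
    refine MvPolynomial.algHom_ext fun w => ?_
    rw [AlgHom.comp_apply, shear_X, shear_X]
    by_cases hwj : w = j
    · rw [hwj, if_pos rfl, if_neg hjl, map_add, map_mul, algHom_C, algebraMap_eq, swapShear_X, swapShear_X, if_pos rfl,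
        if_neg (Ne.symm hjl), if_pos rfl, h1]
      linear_combination (X j) * h2
    · rw [if_neg hwj, swapShear_X, if_neg hwj]
  rw [← key, AlgHom.comp_apply]

/-- Exponent bookkeeping of `swapShear` on a monomial: `u^D ↦ Σ_c binom(D l, c)(−ν)^{D j} g^{D l − c} u_i^{D i} u_j^{D l − c} u_l^{D j + c}`.
[new; elementary] -/
noncomputable def swapExp (i j l : Fin 3) (D : Fin 3 →₀ ℕ) (c : ℕ) : Fin 3 →₀ ℕ :=
  Finsupp.single i (D i) + Finsupp.single j (D l - c) + Finsupp.single l (D j + c)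

/-- `swapExp_apply_fst`: LossShearX2 (lens-3 g28 T6b) helper, VERBATIM from the lens slice; docstring added by the writer (lint.docstring); the statement is its type. [folklore] -/
theorem swapExp_apply_fst (hij : i ≠ j) (hil : i ≠ l) (D : Fin 3 →₀ ℕ) (c : ℕ) : swapExp i j l D c i = D i := by
  simp only [swapExp, Finsupp.add_apply, Finsupp.single_apply, ite_true, if_neg (Ne.symm hij), if_neg (Ne.symm hil), add_zero]

/-- `swapExp_apply_snd`: LossShearX2 (lens-3 g28 T6b) helper, VERBATIM from the lens slice; docstring added by the writer (lint.docstring); the statement is its type. [folklore] -/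
theorem swapExp_apply_snd (hij : i ≠ j) (hjl : j ≠ l) (D : Fin 3 →₀ ℕ) (c : ℕ) : swapExp i j l D c j = D l - c := by
  simp only [swapExp, Finsupp.add_apply, Finsupp.single_apply, ite_true, if_neg hij, if_neg (Ne.symm hjl), add_zero, zero_add]

/-- `swapExp_apply_thd`: LossShearX2 (lens-3 g28 T6b) helper, VERBATIM from the lens slice; docstring added by the writer (lint.docstring); the statement is its type. [folklore] -/
theorem swapExp_apply_thd (hil : i ≠ l) (hjl : j ≠ l) (D : Fin 3 →₀ ℕ) (c : ℕ) : swapExp i j l D c l = D j + c := by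
  simp only [swapExp, Finsupp.add_apply, Finsupp.single_apply, ite_true, if_neg hil, if_neg hjl, zero_add]

omit [DecidableEq K] in
/-- **`swapShear` OF A MONOMIAL (PROVED; binomial theorem).** [folklore] -/
theorem swapShear_monomial (hij : i ≠ j) (hil : i ≠ l) (hjl : j ≠ l) (ν g : K) (D : Fin 3 →₀ ℕ) (r : K) :
    swapShear j l ν g (monomial D r) =
      ∑ c ∈ Finset.range (D l + 1),
        monomial (swapExp i j l D c) (r * (-ν) ^ (D j) * g ^ (D l - c) * ((D l).choose c : K)) := by
  rw [monomial_eq_C_mul_X_pow hij hil hjl D r, map_mul, map_mul, map_mul, map_pow, map_pow, map_pow, swapShear_X,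
    swapShear_X, swapShear_X, if_neg hij, if_neg hil, if_pos rfl, if_neg (Ne.symm hjl), if_pos rfl, algHom_C, algebraMap_eq,
    mul_pow, ← map_pow, add_pow, Finset.mul_sum]
  refine Finset.sum_congr rfl fun c _ => ?_
  rw [mul_pow, ← map_pow, ← map_natCast (C : K →+* MvPolynomial (Fin 3) K) ((D l).choose c)]
  unfold swapExp
  simp only [X_pow_eq_monomial, C_apply, monomial_mul, mul_one, one_mul, add_zero, zero_add]
  rw [monomial_eq_monomial_iff]
  left
  refine ⟨?_, by ring⟩
  ext w
  simp only [Finsupp.add_apply, Finsupp.single_apply]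
  split_ifs <;> omega

omit [DecidableEq K] in
/-- **COEFFICIENTS OF `swapShear` (PROVED):** on the line `(E i, E j + E l)` they are a triangular combination of those of `G`.
[folklore] -/
theorem coeff_swapShear (hij : i ≠ j) (hil : i ≠ l) (hjl : j ≠ l) (ν g : K) (G : MvPolynomial (Fin 3) K) (E : Fin 3 →₀ ℕ) :
    coeff E (swapShear j l ν g G) =
      ∑ D ∈ G.support, ∑ c ∈ Finset.range (D l + 1),
        if swapExp i j l D c = E then coeff D G * (-ν) ^ (D j) * g ^ (D l - c) * ((D l).choose c : K) else 0 := by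
  classical
  conv_lhs => rw [G.as_sum, map_sum, coeff_sum]
  refine Finset.sum_congr rfl fun D _ => ?_
  rw [swapShear_monomial hij hil hjl, coeff_sum]
  refine Finset.sum_congr rfl fun c _ => ?_
  rw [coeff_monomial]

/-! ## §6 Support domination, line by line -/

/-- `q`-th powers in three letters. [new; elementary] -/
theorem isPthPowerExponent_iff_of_fin3 (hij : i ≠ j) (hil : i ≠ l) (hjl : j ≠ l) (d : Fin 3 →₀ ℕ) :
    IsPthPowerExponent q d ↔ q ∣ d i ∧ q ∣ d j ∧ q ∣ d l := by
  constructor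
  · intro h
    have hw : ∀ w, q ∣ d w := fun w => by
      by_cases hw : d w = 0
      · rw [hw]; exact dvd_zero q
      · exact h w (Finsupp.mem_support_iff.mpr hw)
    exact ⟨hw i, hw j, hw l⟩
  · rintro ⟨hi, hj, hl⟩ w _
    rcases fin3_eq_or i j l w hij hil hjl with rfl | rfl | rfl
    · exact hi
    · exact hj
    · exact hl

omit [DecidableEq K] in
/-- **SUPPORT DOMINATION ALONG LINES (PROVED; the heart of (L_X2)).**  For `ν, g ≠ 0` and ANY `G`: every non-`q`-th-power monomial
`u^E` of `G` is matched by a non-`q`-th-power monomial `u^{E'}` of `swapShear G` on the same line (`E' i = E i`, `|E'| = |E|`) with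
`E' l ≤ E j` — take the least non-`q`-th-power `j`-exponent `T ≤ E j` on the line; the triangular coefficient formula has a unit
diagonal term there, the earlier non-`q`-th-power terms are absent, and the earlier `q`-th-power terms die by Lucas (`hLucas`).
[new] -/
theorem exists_dom_swapShear (hij : i ≠ j) (hil : i ≠ l) (hjl : j ≠ l) {ν g : K} (hν : ν ≠ 0) (hg : g ≠ 0)
    (hLucas : ∀ D T : ℕ, q ∣ D → ¬ q ∣ T → ((D.choose T : ℕ) : K) = 0) (G : MvPolynomial (Fin 3) K) {E : Fin 3 →₀ ℕ}
    (hE : E ∈ (deletePthPowers q G).support) :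
    ∃ E' ∈ (deletePthPowers q (swapShear j l ν g G)).support, E' i = E i ∧ E'.degree = E.degree ∧ E' l ≤ E j := by
  classical
  rw [support_deletePthPowers', Finset.mem_filter] at hE
  obtain ⟨hEG, hEP⟩ := hE
  -- the line through `E`: exponents `(E i) e_i + r e_j + (n - r) e_l`, `n = E j + E l`
  set A := E i with hA
  set n := E j + E l with hn
  set lineExp : ℕ → (Fin 3 →₀ ℕ) := fun r => Finsupp.single i A + Finsupp.single j r + Finsupp.single l (n - r) with hlineExp
  have hline_i : ∀ r, lineExp r i = A := fun r => by
    simp only [hlineExp, Finsupp.add_apply, Finsupp.single_apply, ite_true, if_neg (Ne.symm hij), if_neg (Ne.symm hil), add_zero]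
  have hline_j : ∀ r, lineExp r j = r := fun r => by
    simp only [hlineExp, Finsupp.add_apply, Finsupp.single_apply, ite_true, if_neg hij, if_neg (Ne.symm hjl), add_zero, zero_add]
  have hline_l : ∀ r, lineExp r l = n - r := fun r => by
    simp only [hlineExp, Finsupp.add_apply, Finsupp.single_apply, ite_true, if_neg hil, if_neg hjl, zero_add]
  have hE_eq : lineExp (E j) = E := by
    ext w
    rcases fin3_eq_or i j l w hij hil hjl with rfl | rfl | rfl
    · rw [hline_i]
    · rw [hline_j]
    · rw [hline_l]; omega
  have hex : ∃ r, lineExp r ∈ G.support ∧ ¬ IsPthPowerExponent q (lineExp r) := ⟨E j, by rw [hE_eq]; exact ⟨hEG, hEP⟩⟩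
  obtain ⟨hTG, hTP⟩ := Nat.find_spec hex
  set T := Nat.find hex with hT
  have hTle : T ≤ E j := Nat.find_min' hex (by rw [hE_eq]; exact ⟨hEG, hEP⟩)
  have hTn : T ≤ n := le_trans hTle (by omega)
  -- the partner exponent on the X1 side
  set E' : Fin 3 →₀ ℕ := Finsupp.single i A + Finsupp.single j (n - T) + Finsupp.single l T with hE'
  have hE'i : E' i = A := by
    simp only [hE', Finsupp.add_apply, Finsupp.single_apply, ite_true, if_neg (Ne.symm hij), if_neg (Ne.symm hil), add_zero]
  have hE'j : E' j = n - T := by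
    simp only [hE', Finsupp.add_apply, Finsupp.single_apply, ite_true, if_neg hij, if_neg (Ne.symm hjl), add_zero, zero_add]
  have hE'l : E' l = T := by
    simp only [hE', Finsupp.add_apply, Finsupp.single_apply, ite_true, if_neg hil, if_neg hjl, zero_add]
  refine ⟨E', ?_, hE'i, ?_, by rw [hE'l]; exact hTle⟩
  · rw [support_deletePthPowers', Finset.mem_filter, mem_support_iff, coeff_swapShear hij hil hjl]
    refine ⟨?_, ?_⟩
    · rw [Finset.sum_eq_single (lineExp T)]
      · -- the diagonal term: `D = lineExp T`, `c = 0`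
        rw [Finset.sum_eq_single 0]
        · have hexp : swapExp i j l (lineExp T) 0 = E' := by
            ext w
            rcases fin3_eq_or i j l w hij hil hjl with rfl | rfl | rfl
            · rw [swapExp_apply_fst hij hil, hline_i, hE'i]
            · rw [swapExp_apply_snd hij hjl, hline_l, hE'j, Nat.sub_zero]
            · rw [swapExp_apply_thd hil hjl, hline_j, hE'l, add_zero]
          rw [if_pos hexp, hline_j, hline_l, Nat.sub_zero, Nat.choose_zero_right, Nat.cast_one, mul_one]
          exact mul_ne_zero (mul_ne_zero (mem_support_iff.mp hTG) (pow_ne_zero _ (neg_ne_zero.mpr hν))) (pow_ne_zero _ hg)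
        · intro c _ hc0
          rw [if_neg]
          intro h
          have h3 := congrArg (fun D : Fin 3 →₀ ℕ => D l) h
          simp only [swapExp_apply_thd hil hjl, hline_j, hE'l] at h3
          omega
        · intro h; exact absurd (Finset.mem_range.mpr (Nat.succ_pos _)) h
      · -- the off-diagonal terms vanish: absent by minimality, or killed by Lucas
        intro D hD hne
        refine Finset.sum_eq_zero fun c hc => ?_
        split_ifs with h
        · have h1 := congrArg (fun D : Fin 3 →₀ ℕ => D i) h
          have h2 := congrArg (fun D : Fin 3 →₀ ℕ => D j) h
          have h3 := congrArg (fun D : Fin 3 →₀ ℕ => D l) h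
          simp only [swapExp_apply_fst hij hil, hE'i] at h1
          simp only [swapExp_apply_snd hij hjl, hE'j] at h2
          simp only [swapExp_apply_thd hil hjl, hE'l] at h3
          have hc' : c ≤ D l := Nat.lt_succ_iff.mp (Finset.mem_range.mp hc)
          have hDline : D = lineExp (D j) := by
            ext w
            rcases fin3_eq_or i j l w hij hil hjl with rfl | rfl | rfl
            · rw [hline_i, h1]
            · rw [hline_j]
            · rw [hline_l]; omega
          have hr : D j < T := by
            rcases (show D j ≤ T by omega).lt_or_eq with hlt | heq
            · exact hlt
            · exact absurd (by rw [hDline, heq]) hne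
          have hDP : IsPthPowerExponent q D := by
            by_contra hnp
            exact Nat.find_min hex hr ⟨by rw [← hDline]; exact hD, by rw [← hDline]; exact hnp⟩
          rw [isPthPowerExponent_iff_of_fin3 hij hil hjl] at hDP
          obtain ⟨hqA, hqr, hql⟩ := hDP
          have hqc : ¬ q ∣ c := by
            intro hqc
            apply hTP
            rw [isPthPowerExponent_iff_of_fin3 hij hil hjl, hline_i, hline_j, hline_l]
            refine ⟨h1 ▸ hqA, h3 ▸ dvd_add hqr hqc, ?_⟩
            rw [← h2]
            have hsplit : q ∣ c + (D l - c) := by rw [Nat.add_sub_of_le hc']; exact hql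
            exact (Nat.dvd_add_right hqc).mp hsplit
          rw [hLucas (D l) c hql hqc, mul_zero]
        · rfl
      · intro h; exact absurd hTG h
    · -- `E'` is not a `q`-th power (else `lineExp T` would be one)
      intro hP
      apply hTP
      rw [isPthPowerExponent_iff_of_fin3 hij hil hjl] at hP ⊢
      rw [hline_i, hline_j, hline_l]
      rw [hE'i, hE'j, hE'l] at hP
      exact ⟨hP.1, hP.2.2, hP.2.1⟩
  · rw [degree_fin3 hij hil hjl E', degree_fin3 hij hil hjl E, hE'i, hE'j, hE'l]
    omega

omit [DecidableEq K] in
/-- **THE LAW BEHIND (L_X2) (PROVED): support domination between the two prepared equations of one closed point**, for ANY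
equation `F` and any `s`: `ν g = 1 → ShearDom q s i j l ν g F`, granted Lucas for `(K, q)`. [new] -/
theorem shearDom_of_mul_eq_one (hij : i ≠ j) (hli : l ≠ i) (hlj : l ≠ j) {ν g : K} (hνg : ν * g = 1)
    (hLucas : ∀ D T : ℕ, q ∣ D → ¬ q ∣ T → ((D.choose T : ℕ) : K) = 0) (s : ℕ) (F : MvPolynomial (Fin 3) K) :
    ShearDom q s i j l ν g F := by
  have hν : ν ≠ 0 := left_ne_zero_of_mul_eq_one hνg
  have hg : g ≠ 0 := right_ne_zero_of_mul_eq_one hνg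
  have hgν : g * ν = 1 := by rw [mul_comm]; exact hνg
  refine ⟨fun E hE _ => ?_, fun E' hE' _ => ?_⟩
  · obtain ⟨E', hE'S, h1, h2, h3⟩ :=
      exists_dom_swapShear hij (Ne.symm hli) (Ne.symm hlj) hν hg hLucas (shear j l ν F) hE
    rw [swapShear_shear (Ne.symm hlj) hνg] at hE'S
    exact ⟨E', hE'S, h1, h2, h3⟩
  · obtain ⟨E, hES, h1, h2, h3⟩ :=
      exists_dom_swapShear (Ne.symm hli) hij hlj hg hν hLucas (shear l j g F) hE'
    rw [swapShear_shear hlj hgν] at hES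
    exact ⟨E, hES, h1, h2, h3⟩

end Summit.ResolutionOfSingularities.ResolutionOfSingularities.Theorems.LossPolygon

/-! ## §7 The law (L_X2) proved for the walk; the located residual from the one remaining law -/

namespace Summit.ResolutionOfSingularities.ResolutionOfSingularities.Theorems.LossEpisode

open Summit.ResolutionOfSingularities.ResolutionOfSingularities.Theorems.LossPolygon

variable {K : Type} [Field K] [DecidableEq K] {q : ℕ} {s₀ : State (Fin 3) K}

/-- `LawShearDomAt` holds on every window once Lucas holds for `(K, q)` (witness `g = 1/ν`). [new] -/
theorem lawShearDomAt_of_lucas (hLucas : ∀ D T : ℕ, q ∣ D → ¬ q ∣ T → ((D.choose T : ℕ) : K) = 0) (W : ForcedWalk q s₀)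
    (N s : ℕ) : LawShearDomAt W N s := by
  intro u _ i j l k m hS _ _ _ hbj _
  obtain ⟨hij, hli, hlj, -⟩ := hS
  exact ⟨(W.b u j)⁻¹, shearDom_of_mul_eq_one hij hli hlj (mul_inv_cancel₀ hbj) hLucas s _⟩

/-- **`LawShearDom` PROVED** (`q = p^e`, residue characteristic `p`: Lucas applies). [new] -/
theorem lawShearDom : LawShearDom := by
  intro p hp e _ K _ _ _ _ s₀ _ W N s _ _ _ _
  haveI : Fact p.Prime := ⟨hp⟩
  exact lawShearDomAt_of_lucas (fun D T hD hT => cast_choose_eq_zero_of_pow_dvd p hD hT) W N s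

/-- **THE LAW (L_X2) PROVED, hyp-free:** an X2-arrow from a heavy run state on a lossy strict tail does not raise `β`.
First half of the pair `lawX2 ∧ lawLossEntry` (critic letter row 220l). [CJS2020 Lemma 13.3, (1:−λ)-case, for the walk; new] -/
theorem lawX2 : LawX2 :=
  lawX2_of_lawShearDom lawShearDom

/-- **THE LOCATED RESIDUAL FROM THE ONE REMAINING LAW (PROVED):** `LawLossEntry → NoLossyStrictTailsDeep`. [new] -/
theorem noLossyStrictTailsDeep_of_lawLossEntry (hL : LawLossEntry) : NoLossyStrictTailsDeep :=
  noLossyStrictTailsDeep_of_laws lawX2 hL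

end Summit.ResolutionOfSingularities.ResolutionOfSingularities.Theorems.LossEpisode
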